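/-
Copyright (c) 2026. All rights reserved.
Released under Apache 2.0 license as described in the file LICENSE.
-/
import Mathlib
import HarnessLib
import Summits.RiemannHypothesis.RiemannHypothesis.Theorems.EarlyAppointmentsRoucheAux
import Summits.RiemannHypothesis.RiemannHypothesis.Theorems.EarlyAppointmentsCombGHelpers
import Summits.RiemannHypothesis.RiemannHypothesis.Theorems.EarlyAppointmentsGDecompLimit
import Summits.RiemannHypothesis.RiemannHypothesis.Theorems.TiltedLandingLaw421R3NewtonDoor2

/-!
# G variation bound using direct decomposition

Proves |G(z) - G(c)| ≤ 1/h on the circle |z - c| = h/2 by: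
1. Decomposing G into conjugate pole + finset pole sum + remainder
2. Bounding each term's variation using nearSum_variation_of_isolated
3. Using the remainder bound from hremainder
-/

open Complex Real Set Filter Topology Metric
open scoped BigOperators Topology ComplexConjugate

noncomputable section

namespace GVariationDirect

/-- The center point c = x₀ + h·i in the upper half-plane. -/
abbrev c (x₀ h : ℝ) : ℂ := (x₀ : ℂ) + h * Complex.I

/-- The conjugate of the center point: x₀ - h·i. -/
abbrev c_conj (x₀ h : ℝ) : ℂ := (x₀ : ℂ) - h * Complex.I

/-- Variation of conjugate pole term: |1/(z-conj(c)) - 1/(c-conj(c))| ≤ 1/(6h).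
On circle |z-c| = h/2, conjugate is at distance 2h from c, so ≥ 3h/2 from z. -/
theorem conjugate_variation {x₀ h : ℝ} (hh : 0 < h) {z : ℂ} (hz : ‖z - c x₀ h‖ = h / 2) :
    ‖(z - c_conj x₀ h)⁻¹ - (c x₀ h - c_conj x₀ h)⁻¹‖ ≤ 1 / (6 * h) := by
  -- c - conj(c) = 2h*I, |c - conj(c)| = 2h
  have hc_diff : c x₀ h - c_conj x₀ h = 2 * h * I := by simp [c, c_conj]; ring
  have hc_diff_norm : ‖c x₀ h - c_conj x₀ h‖ = 2 * h := by
    rw [hc_diff]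
    calc ‖2 * ↑h * I‖ = ‖((2 * h : ℝ) : ℂ) * I‖ := by norm_cast
      _ = |2 * h| * ‖I‖ := by rw [norm_mul, Complex.norm_real, Real.norm_eq_abs]
      _ = |2 * h| := by rw [Complex.norm_I, mul_one]
      _ = 2 * h := abs_of_pos (by linarith)
  -- z - conj(c) = (z - c) + (c - conj(c)), so |z - conj(c)| ≥ |c - conj(c)| - |z - c| = 2h - h/2 = 3h/2
  have hz_conj_bound : ‖z - c_conj x₀ h‖ ≥ 3 * h / 2 := by
    have h1 : ‖c x₀ h - c_conj x₀ h‖ ≤ ‖z - c x₀ h‖ + ‖z - c_conj x₀ h‖ := by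
      calc ‖c x₀ h - c_conj x₀ h‖ = ‖(c x₀ h - z) + (z - c_conj x₀ h)‖ := by ring_nf
        _ ≤ ‖c x₀ h - z‖ + ‖z - c_conj x₀ h‖ := norm_add_le _ _
        _ = ‖z - c x₀ h‖ + ‖z - c_conj x₀ h‖ := by rw [norm_sub_rev]
    rw [hc_diff_norm, hz] at h1
    linarith
  -- Nonzero denominators
  have hz_ne : z - c_conj x₀ h ≠ 0 := by
    intro h0; rw [h0, norm_zero] at hz_conj_bound; linarith
  have hc_ne : c x₀ h - c_conj x₀ h ≠ 0 := by
    rw [hc_diff]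
    intro habs
    have h1 : ‖2 * ↑h * I‖ = 0 := by rw [habs, norm_zero]
    rw [hc_diff] at hc_diff_norm
    rw [hc_diff_norm] at h1
    linarith
  -- Use 1/a - 1/b = (b - a)/(ab)
  have hdiff : (z - c_conj x₀ h)⁻¹ - (c x₀ h - c_conj x₀ h)⁻¹ =
      ((c x₀ h - c_conj x₀ h) - (z - c_conj x₀ h)) / ((z - c_conj x₀ h) * (c x₀ h - c_conj x₀ h)) := by
    field_simp [hz_ne, hc_ne]
  have hnum : (c x₀ h - c_conj x₀ h) - (z - c_conj x₀ h) = c x₀ h - z := by ring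
  rw [hdiff, hnum, norm_div, norm_mul]
  have hdenom_pos : ‖z - c_conj x₀ h‖ * ‖c x₀ h - c_conj x₀ h‖ > 0 := by
    apply mul_pos (norm_pos_iff.mpr hz_ne) (norm_pos_iff.mpr hc_ne)
  have hdenom_bound : ‖z - c_conj x₀ h‖ * ‖c x₀ h - c_conj x₀ h‖ ≥ (3 * h / 2) * (2 * h) := by
    have h1 : ‖z - c_conj x₀ h‖ ≥ 3 * h / 2 := hz_conj_bound
    have h2 : ‖c x₀ h - c_conj x₀ h‖ = 2 * h := hc_diff_norm
    calc ‖z - c_conj x₀ h‖ * ‖c x₀ h - c_conj x₀ h‖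
        = ‖z - c_conj x₀ h‖ * (2 * h) := by rw [h2]
      _ ≥ (3 * h / 2) * (2 * h) := by nlinarith [h1]
  have hnum_bound : ‖c x₀ h - z‖ ≤ h / 2 := by rw [norm_sub_rev]; exact le_of_eq hz
  -- Numerator / Denominator ≤ (h/2) / (3h²) = 1/(6h)
  have h3h2 : (3 * h / 2) * (2 * h) = 3 * h ^ 2 := by ring
  have hdenom_bound' : ‖z - c_conj x₀ h‖ * ‖c x₀ h - c_conj x₀ h‖ ≥ 3 * h ^ 2 := by
    rw [← h3h2]; exact hdenom_bound
  have h3h2_pos : (0 : ℝ) < 3 * h ^ 2 := by nlinarith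
  calc ‖c x₀ h - z‖ / (‖z - c_conj x₀ h‖ * ‖c x₀ h - c_conj x₀ h‖)
      ≤ (h / 2) / (3 * h ^ 2) := by
        gcongr
    _ = 1 / (6 * h) := by field_simp; ring

end GVariationDirect

end
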